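/-
Origin: expansion seat `planner-pub-hodgecm-mc-axioms-1-g14-0`, handover #W105 2026-08-20T15:53:55Z md5 1af95c846b2d (PKG 7da91f4939a5 → 1af95c846b2d; 360 l.; MECHANICAL (iib-R) rewrite v3.1 of the PKG file as it stands (30 token edits; rules R1x3+RX[h₂']x27)) (`HOME/mc/pub-hodgecm-mc-axioms-1-g14/revendor/kit-r55/stage55/HodgeCM/Model/ArchKTypeOf.lean`, md5 1af95c846b2d, 360 lines);
landed by the gen-22 packager (p-g22) in gate run 55 REPLACES the earlier landed copy of `HodgeCM/Model/ArchKTypeOf.lean` (seat copy carried the packager Origin header of an earlier run (stripped)).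
-/
/-
Copyright (c) 2026. Released under Apache 2.0 license as described in the file LICENSE.
Cell pub-hodgecm, MODEL layer (construction prover mc-carch-1, gen 0), BINDER-OWNERS row 12 `C` / nodes W6a–W6b of
`MODEL-DAG.md`: the honest-pin TERM of E's binder `C : ArchKTypeData (thetaSpaceInputIn … (S V c) hV) k N` through the
smart constructor `ArchKTypeData.ofArchRead`, with the (C-Kf∞)-correct finite `K`-type.
-/
import Summits.HodgeConjecture.HodgeCM.Model.ArchKTypePinTensor
import Summits.HodgeConjecture.HodgeCM.Model.ThetaHolDirections
import Summits.HodgeConjecture.HodgeCM.Model.ThetaSpaceInputPin_2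
import Summits.HodgeConjecture.HodgeCM.Model.ArchSideInstance
import Summits.HodgeConjecture.HodgeCM.Model.Junction.LevelSaturation

/-!
# The archimedean `K`-type datum AT THE PIN (E binder `C`, row 12): the `ofArchRead` term

E (`Model/E2InstanceR15A` :131ff, `_r15AE`) takes
`C : ∀ V c (hV : IsAnisotropic L V.Hm), GoodCtx → [c.K:ℚ] = 6 → ∀ k, k = 0 ∨ k = 1 → ∀ N, 0 < N →
  ArchKTypeData (thetaSpaceInputIn hHD hI h₁ h₃ (S V c) hV) k N`
and reads (AN) `hpd`, (REP) `hk` off it.  BRICK 4 (`Model/ArchKTypeJunction{,ExpP}`, theta-3) proves (AN)/(REP) for ANY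
such datum intertwined with a junction Weil datum; the (C-Kf∞) re-cut (`Model/ArchKType` #R1 / `ArchKTypePin` #R2) fixed
the field `fixN` to the FAMILY form.  This file supplies the TERM itself, at an ABSTRACT adelic side
`S : ThetaAdelicSide V c` in the anisotropic regime `hV` (pin-level typing discipline (J-pinterm) R2: no record term of
the honest `S` appears in a type; every input is a VALUE-LEVEL hypothesis on the fields of `S`, discharged at
`S := Gen12Pins.S …` / `archSideOf …` by the owning lanes):

* § 1 `archKTypeOf` — `ArchKTypeData (thetaSpaceInputIn … S hV) k N` by `ArchKTypeData.ofArchRead` with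
  - level `Γ₀` and FINITE `K`-TYPE **`K₂ := ↥(satLevelRegimeOf V hV K) = Π_{w ≠ w(ι₁)} U(V)(L⁺_w) × K`** (discharge-1
    `Junction/LevelSaturation`; the (C-Kf∞) finding of unitary-2-g6 / model1-g5 07:33Z: the corrector of a level element
    must carry its compact archimedean components, so the finite `K`-type cannot be finite-adelic only), `κ₂ := subtype`;
  - `comm` PROVED from `hK : satLevelRegimeOf V hV K ≤ S.Gfin` and `S.comm_fin` (`hK` holds at the honest
    `S.Gfin := archFinOf V`: `satLevelRegimeOf_le_archFinOf`, § 0);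
  - (Θ-sat, RUN 37 #S4/#S5) `sat` from **`hsat : X.KΓ Γ₀ ≤ satLevelRegimeOf V hV K`** (trivial at `K := Γ₀.K`: the pin's
    `KΓ Γ₀` IS `satLevelRegimeOf V hV Γ₀.K`, `thetaSpaceInputIn_KΓ`);
  - `level` from **`hlevel`** — the level-`Γ₀` elements of `U(2,1)` are corrected into `G_U(L⁺)` by `satLevelRegimeOf V hV K`
    (the conclusion of theta-3's RUN-38 field `ThetaAdelicSide.rat_split_level` + pin lemma
    `exists_toBall_eq_of_mem_levelImage`, at `K := Γ₀.K` of the (W1) `Level` pair);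
  - `ωinf := archReadRep _` of the pure-tensor archimedean factor: **`hA : ∀ g, (S.P k).ω (S.ιinf g, 1) =
    adelicTensorEnd (ωA g) 1`** for an explicit `ωA : Representation ℂ U21 𝓢((Fin 3 → L⁺_∞), ℂ)` (binder-2 (J-a)
    `HypCensus/ArchDatumCM.omega_cmPairSplitting_arch_map_tmul` + tree Collapse p194071 + the `ι₁`-section of #1097),
    so `IsArchTensor (archRestr X k Γ₀)` (`ArchKTypePinTensor`) and `prodN` are PROVED and `ωinf = ωA` pointwise
    (`archKTypeOf_ωinf_apply`);
  - the harmonic family `Φarch`, `ℓ₀`, `arch₀ : Φarch ℓ₀ = (S.P k).Φinf` (theta-3 `ArchLineInputOf` ⊗ the KonnoKonno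
    degree-one family) — DATA + one equation;
  - (W-Kf′) **`hfix : ∀ x ∈ satLevelRegimeOf V hV K, ∀ ℓ, (S.P k).ω (x, 1) φ_N(Φarch ℓ) = φ_N(Φarch ℓ)`** — family form over
    the WHOLE saturation group: the `K` factor is D-2's deep-level fixing (p189030 / p191419 / p191500, (F) framed), the
    compact archimedean factor is (c5) `HypCensus/DefiniteVacuumExponent.exists_exponent_twist_eq_self_of_signs` under the
    (S-norm) archimedean type of the line character at the definite places;
  - (W-K∞′) **`harm : ∀ u ℓ, ωA u (Φarch ℓ) = Φarch (τ₁^∨ u ℓ)`** stated on `ωA` (tree `KonnoKonno2007/JunctionDegreeOneKTypes`,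
    `SegalBargmann/SchwartzDegreeOneKTypes`), transported to the read-off by `IsArchTensor.archReadRep_apply`.
* § 0a `IsArchTensor.factor` — the archimedean factor of a pure-tensor action as a `Representation` (so that `hA`'s
  `ωA` can be TAKEN to be `h.factor` for any `h : IsArchTensor ((S.P k).ω ∘ (S.ιinf ·, 1))`: `eq_adelicTensorEnd_factor`,
  `factor_apply`);
* § 3 `archKTypeFamilyOf` — binder `C` as a FAMILY over E's index from families of the inputs (E's binder type by `β`
  alone; the (AN)/(REP) binders `hpd`/`hk` of the family are `isWeaklyPDiff_archKTypeOf` / `isPMinusKilledAlong_archKTypeOf`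
  pointwise);
* § 2 consequences for THIS `C`: `archKTypeOf_ωinf_apply`, `isArchTensor_archRestr_archKTypeOf`, and E's one-sided
  binders reduced to the archimedean factor on the harmonic family ONLY —
  `isWeaklyPDiff_archKTypeOf` ((AN) ⇐ differentiability of `b ↦ T (ωA (e b) (Φarch ℓ))` at `0`),
  `isPMinusKilledAlong_archKTypeOf` / `isPMinusKilled_archKTypeOf` ((REP) ⇐ the p⁻-limits of `ωA (e ·) (Φarch ℓ)`);
  BRICK 4's `isWeaklyPDiff_of_isBlockPair` / `isPMinusKilledAlong_of_isBlockPair` apply to `archKTypeOf …` verbatim with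
  `hτ` read through `archKTypeOf_ωinf_apply`.

Nothing is cited and nothing is minted: one definition (a term of an existing structure) and kernel lemmas over
installed RUN-36 modules; 0 records, 0 `def … : Prop`.  The five hypothesis families `hlevel / hA / arch₀ / hfix / harm`
are the complete list of what row 12 still owes at the pin, each typed in its supplier's currency.
-/

set_option autoImplicit false

noncomputable section

open MulAction NumberField NumberField.mixedEmbedding
open Literature.Geometry.ComplexHyperbolic.BallModel (U21 x₀)
open Literature.NumberTheory.Automorphic Literature.NumberTheory.Weil1964
open Literature.AlgebraicGeometry.HodgeTheory
open Literature.AlgebraicGeometry.ShimuraVarieties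
open Literature.NumberTheory.Automorphic.PicardCM
open HodgeCM.Model.SupplyInstance HodgeCM.Model.SupplyResidual
open HodgeCM.Model.ThetaSpace
open scoped Classical SchwartzMap Topology
open Filter

namespace HodgeCM
namespace Model

/-! ### § 0a. The archimedean factor of a pure-tensor action, as a representation -/

section Factor

variable {K : Type} [Field K] [NumberField K] {J : Type} [Fintype J] {G : Type*} [Monoid G]
variable {ρ : Representation ℂ G (piSchwartzBruhat K J)}

/-- **The archimedean factor of a pure-tensor action** `ρ = A ⊗ 1`, as a REPRESENTATION of `G` on `𝓢((J → K_∞), ℂ)`: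
the read-off at the base point `0` and level `0` (any `(x₀, N)` gives the same, `IsArchTensor.archReadRep_eq`). -/
def IsArchTensor.factor (h : IsArchTensor ρ) : Representation ℂ G 𝓢((J → mixedSpace K), ℂ) :=
  archReadRep (h.isArchOnTestFun 0 0)

/-- The factor IS the tensor factor: `h.factor g = A` whenever `ρ g = A ⊗ 1`. -/
theorem IsArchTensor.factor_apply (h : IsArchTensor ρ) {g : G}
    {A : 𝓢((J → mixedSpace K), ℂ) →ₗ[ℂ] 𝓢((J → mixedSpace K), ℂ)} (hA : ρ g = adelicTensorEnd A LinearMap.id)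
    (Φ : 𝓢((J → mixedSpace K), ℂ)) : h.factor g Φ = A Φ :=
  h.archReadRep_apply 0 0 hA Φ

/-- **`ρ g = h.factor g ⊗ 1`** for every `g`: a pure-tensor action is the tensor of its factor with `1`. -/
theorem IsArchTensor.eq_adelicTensorEnd_factor (h : IsArchTensor ρ) (g : G) :
    ρ g = adelicTensorEnd (h.factor g : 𝓢((J → mixedSpace K), ℂ) →ₗ[ℂ] _) LinearMap.id := by
  obtain ⟨A, hA⟩ := h g
  rw [hA, LinearMap.ext fun Φ => h.factor_apply hA Φ]

end Factor

/-! ### § 0. The saturation group sits inside the away-from-`ι₁` factor of #1097 -/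

section Saturation

variable {L : CMField} {ι₁ : L →+* ℂ} (V : HermSpace3 L ι₁)

/-- In the regime, `toLatticeModelG V` IS `regimeEquiv` (J0(d) twin = identity, regime collapse = `regimeEquiv`). -/
theorem toLatticeModelG_eq_regimeEquiv_twin (hV : IsAnisotropic L V.Hm)
    (g : ↥(Literature.NumberTheory.Automorphic.adelicUnitaryGroup (L : Type) V.Hm)) :
    toLatticeModelG V g = HodgeCM.Adelic.regimeEquiv L V.Hm hV (Junction.adelicUnitaryGroupTwin L V.Hm g) := by
  rw [toLatticeModelG_apply, HodgeCM.Adelic.toRegime_apply_of L V.Hm hV]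

/-- **`satLevelRegimeOf V hV K ≤ archFinOf V`**: the saturation group of any finite level lies in the away-from-`ι₁`
factor `Gfin` of the honest adelic side (`satLevelOf_le_awayFromCM` mapped into the regime model) — discharges the
hypothesis `hK` of `archKTypeOf` at `S.Gfin := archFinOf V`. -/
theorem satLevelRegimeOf_le_archFinOf (hV : IsAnisotropic L V.Hm)
    (K : Subgroup (UnitaryGroup.finAdelic (↥(maximalRealSubfield L)) L (IsCMField.complexConj L) 3 V.Hm)) :
    (satLevelRegimeOf V hV K : Subgroup (V.latticeModel printFact_unitaryCompact_holds).G) ≤ archFinOf V := by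
  rintro _ ⟨g, hg, rfl⟩
  refine (mem_archFinOf_iff V _).2 ⟨g, satLevelOf_le_awayFromCM V K hg, ?_⟩
  rw [toLatticeModelG_eq_regimeEquiv_twin V hV]
  rfl

end Saturation

/-! ### § 1. The term -/

section Pin

variable (hHD : exists_isReal_hodgeModel) (hI : hodgePQ_independent_of_hodgeModel)
  (h₁ : BallQuotientUniformised)  (h₃ : CMAbelianVarietyRealised)

variable {L : CMField} {ι₁ : L →+* ℂ} {V : HermSpace3 L ι₁} {c : SeesawCtx L}

/-- The archimedean-factor restriction of the pinned input along `S.ιinf` is pure-tensor with factor `ωA`. -/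
theorem isArchTensor_archRestr_thetaSpaceInputIn (S : ThetaAdelicSide V c) (hV : IsAnisotropic L V.Hm) (k : Fin 4)
    (Γ₀ : Level V) (ωA : Representation ℂ U21 𝓢((Fin 3 → mixedSpace (↥(maximalRealSubfield L))), ℂ))
    (hA : ∀ g : U21, (S.P k).ω (S.ιinf g, 1) =
      adelicTensorEnd (K := ↥(maximalRealSubfield L)) (ι := Fin 3) (ωA g) LinearMap.id) :
    IsArchTensor (ArchKTypeData.archRestr (thetaSpaceInputIn hHD hI h₁ h₃ S hV) k Γ₀) :=
  fun g => ⟨ωA g, hA g⟩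

/-- **The archimedean `K`-type datum AT THE PIN** (E binder `C`, per context / type index / level `N`), by the smart
constructor `ArchKTypeData.ofArchRead`: finite `K`-type `satLevelRegimeOf V hV K`, `ωinf` the read-off of the
pure-tensor archimedean factor `ωA`, harmonic family `Φarch` through `(S.P k).Φinf`; hypotheses = the five named
junctions `hK`/`hlevel` (level), `hA` (product structure), `arch₀`, `hfix` ((W-Kf′) family form), `harm` ((W-K∞′)). -/
def archKTypeOf (S : ThetaAdelicSide V c) (hV : IsAnisotropic L V.Hm) (k : Fin 4) (N : ℕ)
    (Γ₀ : Level V)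
    (K : Subgroup (UnitaryGroup.finAdelic (↥(maximalRealSubfield L)) L (IsCMField.complexConj L) 3 V.Hm))
    (hK : (satLevelRegimeOf V hV K : Subgroup (V.latticeModel printFact_unitaryCompact_holds).G) ≤ S.Gfin)
    (hlevel : ∀ δ ∈ levelImage hHD hI h₁ h₃ Γ₀ hV, ∃ x : (V.latticeModel printFact_unitaryCompact_holds).G,
      x ∈ (satLevelRegimeOf V hV K : Subgroup (V.latticeModel printFact_unitaryCompact_holds).G) ∧
        S.ιinf δ * x ∈ (V.latticeModel printFact_unitaryCompact_holds).Γ)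
    (hsat : ∀ g ∈ (thetaSpaceInputIn hHD hI h₁ h₃ S hV).KΓ Γ₀,
      g ∈ (satLevelRegimeOf V hV K : Subgroup (V.latticeModel printFact_unitaryCompact_holds).G))
    (ωA : Representation ℂ U21 𝓢((Fin 3 → mixedSpace (↥(maximalRealSubfield L))), ℂ))
    (hA : ∀ g : U21, (S.P k).ω (S.ιinf g, 1) =
      adelicTensorEnd (K := ↥(maximalRealSubfield L)) (ι := Fin 3) (ωA g) LinearMap.id)
    (Φarch : Module.Dual ℂ (Fin 2 → ℂ) →ₗ[ℂ] 𝓢((Fin 3 → mixedSpace (↥(maximalRealSubfield L))), ℂ))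
    (ℓ₀ : Module.Dual ℂ (Fin 2 → ℂ)) (arch₀ : Φarch ℓ₀ = (S.P k).Φinf)
    (hfix : ∀ x : (V.latticeModel printFact_unitaryCompact_holds).G,
      x ∈ (satLevelRegimeOf V hV K : Subgroup (V.latticeModel printFact_unitaryCompact_holds).G) →
      ∀ ℓ : Module.Dual ℂ (Fin 2 → ℂ),
      (S.P k).ω (x, 1) (testFun (↥(maximalRealSubfield L)) (Fin 3) (Φarch ℓ) (S.P k).x₀ N) =
        testFun (↥(maximalRealSubfield L)) (Fin 3) (Φarch ℓ) (S.P k).x₀ N)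
    (harm : ∀ (u : ↥(stabilizer U21 x₀)) (ℓ : Module.Dual ℂ (Fin 2 → ℂ)),
      ωA (u : U21) (Φarch ℓ) = Φarch ((BallForms.isPullbackCocycle_cotangentCocycle.weightOf x₀).dual u ℓ)) :
    ArchKTypeData (thetaSpaceInputIn hHD hI h₁ h₃ S hV) k N :=
  ArchKTypeData.ofArchRead Γ₀
    (ArchKTypeData.isArchOnTestFun_archRestr_of_isArchTensor Γ₀
      (isArchTensor_archRestr_thetaSpaceInputIn hHD hI h₁ h₃ S hV k Γ₀ ωA hA) N)
    ↥(satLevelRegimeOf V hV K) (satLevelRegimeOf V hV K).subtype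
    (fun m x => S.comm_fin x m.1 (hK m.2))
    (fun δ hδ => by
      obtain ⟨x, hx, h⟩ := hlevel δ hδ
      refine ⟨⟨x, hx⟩, ?_⟩
      show S.ιinf δ * x ∈ (S.P k).ΓU
      rw [S.hΓU k]
      exact h)
    (fun g hg => ⟨⟨g, hsat g hg⟩, rfl⟩)
    Φarch ℓ₀ arch₀ (fun m ℓ => hfix m.1 m.2 ℓ)
    (fun (u : ↥(stabilizer U21 x₀)) ℓ =>
      ((isArchTensor_archRestr_thetaSpaceInputIn hHD hI h₁ h₃ S hV k Γ₀ ωA hA).archReadRep_apply _ N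
          (g := (u : U21)) (hA (u : U21)) (Φarch ℓ)).trans (harm u ℓ))

end Pin

/-! ### § 2. Consequences for this `C`: fields, `ωinf = ωA`, and E's one-sided binders on the archimedean factor -/

section Consequences

variable (hHD : exists_isReal_hodgeModel) (hI : hodgePQ_independent_of_hodgeModel)
  (h₁ : BallQuotientUniformised)  (h₃ : CMAbelianVarietyRealised)

variable {L : CMField} {ι₁ : L →+* ℂ} {V : HermSpace3 L ι₁} {c : SeesawCtx L}
  (S : ThetaAdelicSide V c) (hV : IsAnisotropic L V.Hm) (k : Fin 4) (N : ℕ) (Γ₀ : Level V)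
  (K : Subgroup (UnitaryGroup.finAdelic (↥(maximalRealSubfield L)) L (IsCMField.complexConj L) 3 V.Hm))
  (hK : (satLevelRegimeOf V hV K : Subgroup (V.latticeModel printFact_unitaryCompact_holds).G) ≤ S.Gfin)
  (hlevel : ∀ δ ∈ levelImage hHD hI h₁ h₃ Γ₀ hV, ∃ x : (V.latticeModel printFact_unitaryCompact_holds).G,
    x ∈ (satLevelRegimeOf V hV K : Subgroup (V.latticeModel printFact_unitaryCompact_holds).G) ∧
      S.ιinf δ * x ∈ (V.latticeModel printFact_unitaryCompact_holds).Γ)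
  (hsat : ∀ g ∈ (thetaSpaceInputIn hHD hI h₁ h₃ S hV).KΓ Γ₀,
    g ∈ (satLevelRegimeOf V hV K : Subgroup (V.latticeModel printFact_unitaryCompact_holds).G))
  (ωA : Representation ℂ U21 𝓢((Fin 3 → mixedSpace (↥(maximalRealSubfield L))), ℂ))
  (hA : ∀ g : U21, (S.P k).ω (S.ιinf g, 1) =
    adelicTensorEnd (K := ↥(maximalRealSubfield L)) (ι := Fin 3) (ωA g) LinearMap.id)
  (Φarch : Module.Dual ℂ (Fin 2 → ℂ) →ₗ[ℂ] 𝓢((Fin 3 → mixedSpace (↥(maximalRealSubfield L))), ℂ))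
  (ℓ₀ : Module.Dual ℂ (Fin 2 → ℂ)) (arch₀ : Φarch ℓ₀ = (S.P k).Φinf)
  (hfix : ∀ x : (V.latticeModel printFact_unitaryCompact_holds).G,
    x ∈ (satLevelRegimeOf V hV K : Subgroup (V.latticeModel printFact_unitaryCompact_holds).G) →
    ∀ ℓ : Module.Dual ℂ (Fin 2 → ℂ),
    (S.P k).ω (x, 1) (testFun (↥(maximalRealSubfield L)) (Fin 3) (Φarch ℓ) (S.P k).x₀ N) =
      testFun (↥(maximalRealSubfield L)) (Fin 3) (Φarch ℓ) (S.P k).x₀ N)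
  (harm : ∀ (u : ↥(stabilizer U21 x₀)) (ℓ : Module.Dual ℂ (Fin 2 → ℂ)),
    ωA (u : U21) (Φarch ℓ) = Φarch ((BallForms.isPullbackCocycle_cotangentCocycle.weightOf x₀).dual u ℓ))

/-- (Ported verbatim from the HodgeCMPerL package; no docstring in the source.) -/
@[simp] theorem archKTypeOf_Γ₀ :
    (archKTypeOf hHD hI h₁ h₃ S hV k N Γ₀ K hK hlevel hsat ωA hA Φarch ℓ₀ arch₀ hfix harm).Γ₀ = Γ₀ := rfl

/-- (Ported verbatim from the HodgeCMPerL package; no docstring in the source.) -/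
@[simp] theorem archKTypeOf_Φarch :
    (archKTypeOf hHD hI h₁ h₃ S hV k N Γ₀ K hK hlevel hsat ωA hA Φarch ℓ₀ arch₀ hfix harm).Φarch = Φarch := rfl

/-- (Ported verbatim from the HodgeCMPerL package; no docstring in the source.) -/
@[simp] theorem archKTypeOf_ℓ₀ :
    (archKTypeOf hHD hI h₁ h₃ S hV k N Γ₀ K hK hlevel hsat ωA hA Φarch ℓ₀ arch₀ hfix harm).ℓ₀ = ℓ₀ := rfl

/-- The finite `K`-type of the term is the saturation group `Π_{w ≠ w(ι₁)} U(V)(L⁺_w) × K` of the level. -/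
theorem archKTypeOf_K₂ :
    (archKTypeOf hHD hI h₁ h₃ S hV k N Γ₀ K hK hlevel hsat ωA hA Φarch ℓ₀ arch₀ hfix harm).K₂ =
      ↥(satLevelRegimeOf V hV K) := rfl

/-- (Ported verbatim from the HodgeCMPerL package; no docstring in the source.) -/
theorem archKTypeOf_κ₂_apply (m : ↥(satLevelRegimeOf V hV K)) :
    (archKTypeOf hHD hI h₁ h₃ S hV k N Γ₀ K hK hlevel hsat ωA hA Φarch ℓ₀ arch₀ hfix harm).κ₂ m = m.1 := rfl

/-- The restricted pair action along `S.ιinf` at the term's level is pure-tensor. -/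
theorem isArchTensor_archRestr_archKTypeOf :
    IsArchTensor (ArchKTypeData.archRestr (thetaSpaceInputIn hHD hI h₁ h₃ S hV) k
      (archKTypeOf hHD hI h₁ h₃ S hV k N Γ₀ K hK hlevel hsat ωA hA Φarch ℓ₀ arch₀ hfix harm).Γ₀) :=
  isArchTensor_archRestr_thetaSpaceInputIn hHD hI h₁ h₃ S hV k Γ₀ ωA hA

/-- **`ωinf` of the term IS the archimedean factor `ωA`** (read-off of a pure-tensor action,
`IsArchTensor.archReadRep_apply`). -/
@[simp] theorem archKTypeOf_ωinf_apply (g : U21) (Φ : 𝓢((Fin 3 → mixedSpace (↥(maximalRealSubfield L))), ℂ)) :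
    (archKTypeOf hHD hI h₁ h₃ S hV k N Γ₀ K hK hlevel hsat ωA hA Φarch ℓ₀ arch₀ hfix harm).ωinf g Φ = ωA g Φ :=
  (isArchTensor_archRestr_thetaSpaceInputIn hHD hI h₁ h₃ S hV k Γ₀ ωA hA).archReadRep_apply _ N (hA g) Φ

/-- **(AN) for the term ⇐ (AN) of the archimedean factor on the harmonic family**: E's binder `hpd` for this `C`
(at `e := BallForms.expP`) asks only that `b ↦ T (ωA (e b) (Φ_∞(ℓ)))` be real-differentiable at `0`. -/
theorem isWeaklyPDiff_archKTypeOf {P' : Type*} [NormedAddCommGroup P'] [NormedSpace ℝ P'] (e : P' → U21)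
    (h : ∀ (T : 𝓢((Fin 3 → mixedSpace (↥(maximalRealSubfield L))), ℂ) →L[ℂ] ℂ) (ℓ : Module.Dual ℂ (Fin 2 → ℂ)),
      DifferentiableAt ℝ (fun b => T (ωA (e b) (Φarch ℓ))) 0) :
    (archKTypeOf hHD hI h₁ h₃ S hV k N Γ₀ K hK hlevel hsat ωA hA Φarch ℓ₀ arch₀ hfix harm).IsWeaklyPDiff e :=
  fun T ℓ => by
    simp only [archKTypeOf_ωinf_apply, archKTypeOf_Φarch]
    exact h T ℓ

/-- **(REP) along `v` for the term ⇐ the p⁻-limits of the archimedean factor on the harmonic family**: E's binder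
`hk` for this `C` in the END-STATE shape `∀ p, C.IsPMinusKilledAlong expP (-I • e_p)`. -/
theorem isPMinusKilledAlong_archKTypeOf {P' : Type*} [NormedAddCommGroup P'] [NormedSpace ℝ P'] [Module ℂ P']
    (e : P' → U21) (v : P')
    (h : ∀ ℓ : Module.Dual ℂ (Fin 2 → ℂ), ∃ D Dᵢ : 𝓢((Fin 3 → mixedSpace (↥(maximalRealSubfield L))), ℂ),
      Tendsto (fun t : ℝ => t⁻¹ • (ωA (e (t • v)) (Φarch ℓ) - Φarch ℓ)) (𝓝[≠] 0) (𝓝 D) ∧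
        Tendsto (fun t : ℝ => t⁻¹ • (ωA (e (t • (Complex.I • v))) (Φarch ℓ) - Φarch ℓ)) (𝓝[≠] 0) (𝓝 Dᵢ) ∧
          D + Complex.I • Dᵢ = 0) :
    (archKTypeOf hHD hI h₁ h₃ S hV k N Γ₀ K hK hlevel hsat ωA hA Φarch ℓ₀ arch₀ hfix harm).IsPMinusKilledAlong e v :=
  fun ℓ => by
    simp only [archKTypeOf_ωinf_apply, archKTypeOf_Φarch]
    exact h ℓ

/-- (REP) in the form `IsPMinusKilled` (all directions). -/
theorem isPMinusKilled_archKTypeOf {P' : Type*} [NormedAddCommGroup P'] [NormedSpace ℝ P'] [Module ℂ P']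
    (e : P' → U21)
    (h : ∀ (v : P') (ℓ : Module.Dual ℂ (Fin 2 → ℂ)), ∃ D Dᵢ : 𝓢((Fin 3 → mixedSpace (↥(maximalRealSubfield L))), ℂ),
      Tendsto (fun t : ℝ => t⁻¹ • (ωA (e (t • v)) (Φarch ℓ) - Φarch ℓ)) (𝓝[≠] 0) (𝓝 D) ∧
        Tendsto (fun t : ℝ => t⁻¹ • (ωA (e (t • (Complex.I • v))) (Φarch ℓ) - Φarch ℓ)) (𝓝[≠] 0) (𝓝 Dᵢ) ∧
          D + Complex.I • Dᵢ = 0) :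
    (archKTypeOf hHD hI h₁ h₃ S hV k N Γ₀ K hK hlevel hsat ωA hA Φarch ℓ₀ arch₀ hfix harm).IsPMinusKilled e :=
  fun v => isPMinusKilledAlong_archKTypeOf hHD hI h₁ h₃ S hV k N Γ₀ K hK hlevel hsat ωA hA Φarch ℓ₀ arch₀ hfix harm
    e v (h v)

end Consequences

/-! ### § 3. The E-currency family (binder `C` of `Model.perL_picardCM_r15A[E]`, and its `hpd` / `hk`) -/

section Family

variable (hHD : exists_isReal_hodgeModel) (hI : hodgePQ_independent_of_hodgeModel)
  (h₁ : BallQuotientUniformised)  (h₃ : CMAbelianVarietyRealised)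

/-- **Binder `C` as a FAMILY** over E's index `(V, c, hV, hc, h6, k, hk, N, hN)`, from families of the inputs of
`archKTypeOf`.  `Good V c` stands for E's guard `(thetaModelOf …).GoodCtx ι₁ c` (instantiate it so; the constructor does
not use it, nor `h6`), so that `archKTypeFamilyOf … Good S Γ₀ K … harm` has E's binder type
`∀ {L ι₁} (V) (c) (hV), GoodCtx → [c.K:ℚ] = 6 → ∀ k, k = 0 ∨ k = 1 → ∀ N, 0 < N → ArchKTypeData (thetaSpaceInputIn … (S V c) hV) k N`
by `β`-reduction alone (no cast, no record term in any type: (J-pinterm) R1/R2).  Index discipline: the level data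
`Γ₀`, `K` may depend on `(V, c, k, N)`; the archimedean factor `ωA` and the harmonic family `Φarch`, `ℓ₀` on `(V, c, k)`
only (level independence, `ArchKTypePinTensor`); the five junction families may use `hV`, `hk`, `hN`. -/
def archKTypeFamilyOf
    (Good : ∀ {L : CMField} {ι₁ : L →+* ℂ}, HermSpace3 L ι₁ → SeesawCtx L → Prop)
    (S : ∀ {L : CMField} {ι₁ : L →+* ℂ} (V : HermSpace3 L ι₁) (c : SeesawCtx L), ThetaAdelicSide V c)
    (Γ₀ : ∀ {L : CMField} {ι₁ : L →+* ℂ} (V : HermSpace3 L ι₁), SeesawCtx L → Fin 4 → ℕ → Level V)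
    (K : ∀ {L : CMField} {ι₁ : L →+* ℂ} (V : HermSpace3 L ι₁), SeesawCtx L → Fin 4 → ℕ →
      Subgroup (UnitaryGroup.finAdelic (↥(maximalRealSubfield L)) L (IsCMField.complexConj L) 3 V.Hm))
    (hK : ∀ {L : CMField} {ι₁ : L →+* ℂ} (V : HermSpace3 L ι₁) (c : SeesawCtx L) (hV : IsAnisotropic L V.Hm)
      (k : Fin 4) (N : ℕ),
      (satLevelRegimeOf V hV (K V c k N) : Subgroup (V.latticeModel printFact_unitaryCompact_holds).G) ≤ (S V c).Gfin)
    (hlevel : ∀ {L : CMField} {ι₁ : L →+* ℂ} (V : HermSpace3 L ι₁) (c : SeesawCtx L) (hV : IsAnisotropic L V.Hm)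
      (k : Fin 4) (N : ℕ), ∀ δ ∈ levelImage hHD hI h₁ h₃ (Γ₀ V c k N) hV,
        ∃ x : (V.latticeModel printFact_unitaryCompact_holds).G,
          x ∈ (satLevelRegimeOf V hV (K V c k N) : Subgroup (V.latticeModel printFact_unitaryCompact_holds).G) ∧
            (S V c).ιinf δ * x ∈ (V.latticeModel printFact_unitaryCompact_holds).Γ)
    (hsat : ∀ {L : CMField} {ι₁ : L →+* ℂ} (V : HermSpace3 L ι₁) (c : SeesawCtx L) (hV : IsAnisotropic L V.Hm)
      (k : Fin 4) (N : ℕ), ∀ g ∈ (thetaSpaceInputIn hHD hI h₁ h₃ (S V c) hV).KΓ (Γ₀ V c k N),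
        g ∈ (satLevelRegimeOf V hV (K V c k N) : Subgroup (V.latticeModel printFact_unitaryCompact_holds).G))
    (ωA : ∀ {L : CMField} {ι₁ : L →+* ℂ}, HermSpace3 L ι₁ → SeesawCtx L → Fin 4 →
      Representation ℂ U21 𝓢((Fin 3 → mixedSpace (↥(maximalRealSubfield L))), ℂ))
    (hA : ∀ {L : CMField} {ι₁ : L →+* ℂ} (V : HermSpace3 L ι₁) (c : SeesawCtx L) (k : Fin 4) (g : U21),
      ((S V c).P k).ω ((S V c).ιinf g, 1) =
        adelicTensorEnd (K := ↥(maximalRealSubfield L)) (ι := Fin 3) (ωA V c k g) LinearMap.id)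
    (Φarch : ∀ {L : CMField} {ι₁ : L →+* ℂ}, HermSpace3 L ι₁ → SeesawCtx L → Fin 4 →
      (Module.Dual ℂ (Fin 2 → ℂ) →ₗ[ℂ] 𝓢((Fin 3 → mixedSpace (↥(maximalRealSubfield L))), ℂ)))
    (ℓ₀ : ∀ {L : CMField} {ι₁ : L →+* ℂ}, HermSpace3 L ι₁ → SeesawCtx L → Fin 4 → Module.Dual ℂ (Fin 2 → ℂ))
    (arch₀ : ∀ {L : CMField} {ι₁ : L →+* ℂ} (V : HermSpace3 L ι₁) (c : SeesawCtx L) (k : Fin 4),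
      Φarch V c k (ℓ₀ V c k) = ((S V c).P k).Φinf)
    (hfix : ∀ {L : CMField} {ι₁ : L →+* ℂ} (V : HermSpace3 L ι₁) (c : SeesawCtx L) (hV : IsAnisotropic L V.Hm)
      (k : Fin 4), k = 0 ∨ k = 1 → ∀ N : ℕ, 0 < N →
      ∀ x : (V.latticeModel printFact_unitaryCompact_holds).G,
        x ∈ (satLevelRegimeOf V hV (K V c k N) : Subgroup (V.latticeModel printFact_unitaryCompact_holds).G) →
        ∀ ℓ : Module.Dual ℂ (Fin 2 → ℂ),
          ((S V c).P k).ω (x, 1) (testFun (↥(maximalRealSubfield L)) (Fin 3) (Φarch V c k ℓ) ((S V c).P k).x₀ N) =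
            testFun (↥(maximalRealSubfield L)) (Fin 3) (Φarch V c k ℓ) ((S V c).P k).x₀ N)
    (harm : ∀ {L : CMField} {ι₁ : L →+* ℂ} (V : HermSpace3 L ι₁) (c : SeesawCtx L) (k : Fin 4), k = 0 ∨ k = 1 →
      ∀ (u : ↥(stabilizer U21 x₀)) (ℓ : Module.Dual ℂ (Fin 2 → ℂ)),
        ωA V c k (u : U21) (Φarch V c k ℓ) =
          Φarch V c k ((BallForms.isPullbackCocycle_cotangentCocycle.weightOf x₀).dual u ℓ))
    {L : CMField} {ι₁ : L →+* ℂ} (V : HermSpace3 L ι₁) (c : SeesawCtx L) (hV : IsAnisotropic L V.Hm)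
    (_hc : Good V c) (_h6 : Module.finrank ℚ c.K = 6) (k : Fin 4) (hk : k = 0 ∨ k = 1) (N : ℕ) (hN : 0 < N) :
    ArchKTypeData (thetaSpaceInputIn hHD hI h₁ h₃ (S V c) hV) k N :=
  archKTypeOf hHD hI h₁ h₃ (S V c) hV k N (Γ₀ V c k N) (K V c k N) (hK V c hV k N) (hlevel V c hV k N)
    (hsat V c hV k N) (ωA V c k) (hA V c k) (Φarch V c k) (ℓ₀ V c k) (arch₀ V c k) (hfix V c hV k hk N hN) (harm V c k hk)

end Family

end Model
end HodgeCM

end
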